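import Summits.QuantumFields.YangMills.Theorems.BalabanUVNodesN15CurvedGluingCubeDressedGeneralRemainderRowAdjointDefect
import HarnessLib

/-!
# Route «BalabanUVNodes» (cluster K4 «SpineRates»), Track-A DAG node N15 = NE2, BACKGROUND LAYER — THE η-DEFECT OF THE ADJOINT REMAINDER ROW OF THE GENERAL DRESSED CUBE, ASSEMBLED: FILE 58's
# `hDKL` shape `𝔇(X′∘[Σ∇′*∇′ + W′ + N′ − 𝒱′, M_{h′}], X∘[Σ∇*∇ + W + N − 𝒱, M_h]) ≤ 1_S(y)·r₀ᴸ·e^{−ρd}` from the flat half (`…RemainderRowAdjointDefect`), the nonlocal summand's Leibniz and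
# the dressed perturbation's adjoint half (`…CommutatorAdjoint`) — the adjoint twin of dag-n15-w4's `…RemainderRowDefectAssembly`

Cell `pub-ymgap`, seat `pub-ymgap-dag-n15-w5` (WIDTH SEAT w5 on node N15, director-ym R399 (3a) ∕ HUMAN RULING D-0149; sequel (g′) of this seat's (g), CONDITIONAL CLAIM-2 I.31237).
`bears_on: R4∕N15 · K3⁷ SpineGivenEndpointR13SepCoPH (stmt-QuantumFields-20544)`.  Filed `--kind proof --supports stmt-QuantumFields-20544 --as helper` — COUNT-NEUTRAL.  Theorems only;
0 `def`, 0 `sorry`.  Imports BY NAME this seat's `…RemainderRowAdjointDefect` (`hasMaj_idef_comp_commOp_lapOp_dressedV_loc₂`; through it `…RemainderRowAdjoint`, `…CommutatorAdjoint`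
(`hasMaj_idef_comp_commOp_of_add`, `hasMaj_idef_comp_commOp_speciesOpM_add`, `unstackM_add_base_comp_jet`), dag-n15-w4 `…RemainderRow` (`commOp_sub_left`), dag-n15-w3 g4 `…RightEntries`,
files 23∕24); nothing in the tree is modified, nothing re-declared.

WHY.  One theorem: ★★★ `hasMaj_idef_dressedV_comp_commOp_cubeOp_out`.  With the cube operator `Σ∇*∇ + W + N − 𝒱`, `𝒱 = (unstackM C A + N_V∘pr₀)∘jet = V(C, A) + N_V` at both grids, the defect of
the adjoint row splits (`idef_sub`) into `𝔇(X′∘[Σ∇′*∇′ + W′ + N′, ·], X∘[Σ∇*∇ + W + N, ·])` — this seat's generic Leibniz `hasMaj_idef_comp_commOp_of_add` on the two-sided flat half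
(`…RemainderRowAdjointDefect` §2), the fine dressed entry 0 (file 23), the entry-0 defect (file 24) and FILE 56's letters of `[N, M_h]` and its defect — minus `𝔇(X′∘[V′ + N′_V, ·], X∘[V + N_V, ·])`
— this seat's `hasMaj_idef_comp_commOp_speciesOpM_add` on the fine dressed entries ∕ right entries (file 23, dag-n15-w3 g4), their defects (file 24, dag-n15-w3 g4), the species rows∕fits, the
partition letters∕fits and the base perturbation's letters∕defect.  Result: `≤ 1_S(y)·r₀ᴸ·e^{−ρ₃d}` with `r₀ᴸ` the displayed sum — FILE 58 `gluedLetters_of_cubeRows_in`'s `hDKL` for the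
dressed cube, by name.

HONEST FRAMING ∕ LIMITS.  Pure assembly over DISPLAYED letters (both grids' flat-cube entries ∕ right entries ∕ defects ∕ cut-offs, the perturbations' letters `R` and fit `o`, species rows
`r_A` ∕ fits `o_At`, partition letters `c₀, c₁, c₂` ∕ fits `o₀, o₁, o₂, o` ∕ block-constant comparison `ℓ, ω`, the `W`-row defect `r_W`, the flat nonlocal summand's commutator letter `c_N` and
defect `r_N`, the base perturbation's `c_V, r_V, δ_N`); [B5] (1.120)–(1.128) pp. 37–39, [B6] (2.91)–(2.92) p. 239 ∕ (2.133)–(2.134) p. 247, [B9] (3.52) ∕ (3.62)–(3.65) ∕ (3.76)–(3.77) ∕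
Thm 3.14 = SHAPES ∕ MECHANISM — nothing of [B5]∕[B6]∕[B9] asserted.  NE2⁺ NOT PRINTED, NOT proved; N15 NOT discharged; counts of record UNMOVED (typed 28∕28 · discharged 5∕27); no summit
statement is proved here; one finite 𝕋⁴ at fixed ε — NOT infinite volume, NOT OS on ℝ⁴, NOT a mass gap, NOT Clay; R4 closes the conditional finite-𝕋⁴ rung `BalabanLadder.UV` only.
Restate-immune (no Theses import).
-/

set_option autoImplicit false

noncomputable section
open scoped BigOperators
open Finset

namespace Summit.QuantumFields.YangMills.BalabanUVNodes.N15.CurvedSpecies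

open Literature.MathematicalPhysics.QuantumFieldTheory.Balaban1983to89
open Literature.MathematicalPhysics.QuantumFieldTheory.Balaban1983to89.B11SectG (BlockNorm HasMaj RowSum)
open Literature.MathematicalPhysics.QuantumFieldTheory.Balaban1983to89.B6RandomWalk (Triangle254)
open Literature.MathematicalPhysics.QuantumFieldTheory.Balaban1983to89.T4EtaRateDefect (idef idef_sub)
open Literature.MathematicalPhysics.QuantumFieldTheory.Balaban1983to89.T4EtaRateCoeffDefect (pull)
open Literature.MathematicalPhysics.QuantumFieldTheory.Balaban1983to89.B6Prop26Gluing (mulOp mulOp_apply ind ind_nonneg)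
open Summit.QuantumFields.YangMills.BalabanUVNodes.N15.MatrixSpecies (liftBlk liftMap liftEquiv liftEquiv_apply liftEquiv_symm_apply)
open Summit.QuantumFields.YangMills.BalabanUVNodes.N15.BackgroundLayer (fgrad bgrad fgradAdj fgrad_apply bgrad_apply stack projO blkPair liftPair unstackM bgPropV)
open Summit.QuantumFields.YangMills.BalabanUVNodes.N15.Gluing (commOp lapOp)

section Assembly

variable {X X' ι J : Type} [Fintype X] [Fintype X'] [DecidableEq X] [DecidableEq X'] [Fintype ι] [DecidableEq ι] [Fintype J] [DecidableEq J] {g : B6.Geometry}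
  (blk : X → g.Site) (π : X' → X) (τ : J → X ≃ X) (τ' : J → X' ≃ X') (n n' : ℝ) (C : X → Matrix ι ι ℝ) (C' : X' → Matrix ι ι ℝ) (A : J ⊕ J → X → Matrix ι ι ℝ)
  (A' : J ⊕ J → X' → Matrix ι ι ℝ) (hX : X → ℝ) (hX' : X' → ℝ) {σ cr : ℝ} {G₀ : (X × ι → ℝ) →ₗ[ℝ] (X × ι → ℝ)} {D Dq : J ⊕ J → (X × ι → ℝ) →ₗ[ℝ] (X × ι → ℝ)}
  {NV : (X × ι → ℝ) →ₗ[ℝ] (X × ι → ℝ)} {G₀' : (X' × ι → ℝ) →ₗ[ℝ] (X' × ι → ℝ)} {D' Dq' : J ⊕ J → (X' × ι → ℝ) →ₗ[ℝ] (X' × ι → ℝ)} {NV' : (X' × ι → ℝ) →ₗ[ℝ] (X' × ι → ℝ)}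

/-- ★★★ **THE η-DEFECT OF THE ADJOINT REMAINDER ROW OF THE DRESSED CUBE, FILE 58's `hDKL` SHAPE.**  Data: `…RemainderRowAdjointDefect` §2's (both grids' flat cubes, right entries, defects, cut-offs
with margins, the perturbations `V̂ = unstackM C A + N_V∘pr₀`, `V̂′ = unstackM C′ A′ + N′_V∘pr₀` with letters `R` and fit `o`, `βRc_r² < 1`, the vector-carrier partition letters `c₁, c₂` and the
five translated fits `o₁, o₂`, the `W`-row defect `r_W`); `…CommutatorAdjoint`'s (scalar partition letters `c₁, c₀` at both grids, plain fits `o₁, o₀`, `|h′ − h∘π| ≤ o`, block-constant comparison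
`ℓ, ω`, species rows `r_A` and translated fits `o_At`, the base perturbation `N_V, N′_V ≤ c_V·e^{−δ_Nd}` with defect `𝔇(N′_V, N_V) ≤ r_V·e^{−δ_Nd}`, `ε > 0`); the flat nonlocal summand through
`[N, M_h] ≤ c_N·e^{−ρ_Nd}` and `𝔇([N′, M_{h′}], [N, M_h]) ≤ r_N·e^{−ρ_Nd}`; symmetric distance; rates `0 ≤ ρ₃ ≤ ρ_N`, `ρ₃ ≤ δ_N − ε`, `ρ₃ + σ ≤ ρ₂`.  Then
`𝔇(X′∘[Σ∇′*∇′ + W′ + N′ − 𝒱′, M_{h′}], X∘[Σ∇*∇ + W + N − 𝒱, M_h]) ≤ 1_S(y)·r₀ᴸ·e^{−ρ₃d}`, `r₀ᴸ = (r_flat + β′r_Nc_r + M₀c_Nc_r) + (r_V^sp + β′r_Kc_r + M₀c_Kc_r)` with `r_flat` =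
`…RemainderRowAdjointDefect` §2's constant, `r_V^sp = |J|·2(r_A(c₁M₀ + o₁β′ + c₀M₁ + o₀β′₂) + o_At(c₁β′ + c₀β′₂))`, `c_K = (ℓ(eε)⁻¹ + 2ω)c_V`, `r_K = (ℓ(eε)⁻¹ + 2ω)r_V + 2o·c_V`, and `β′, β′₂, M₀, M₁`
as there.
[cite: Balaban1984PropagatorsI, (1.120)–(1.128) pp.37–38, p.39 (adjoint representation); Balaban1984PropagatorsII, (2.91)–(2.92) p.239, (2.133)–(2.134) p.247 (shapes + mechanism); Balaban1985BackgroundPropagators, (3.52) p.400, (3.62)–(3.65) pp.402–403, (3.76)–(3.77) pp.405–406, Thm 3.14 pp.426–427 (template)] -/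
theorem hasMaj_idef_dressedV_comp_commOp_cubeOp_out (htri : Triangle254 g) (hd : ∀ a b : g.Site, 0 ≤ g.dist a b) (hsymm : ∀ y y', g.dist y y' = g.dist y' y) (hrow : RowSum g σ cr)
    (hσ : 0 ≤ σ) (hcr : 0 ≤ cr) {ρ₁ ρ₂ ρ₃ ρN δ δV δN ε β β₂ R o mG mQ c₀ c₁ c₂ o₀ o₁ o₂ oo rW rA oAt cN rN cV rV ℓ ω : ℝ} (hβ : 0 ≤ β) (hβ₂ : 0 ≤ β₂) (hR : 0 ≤ R) (ho : 0 ≤ o)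
    (hmG : 0 ≤ mG) (hmQ : 0 ≤ mQ) (hσρ : σ ≤ ρ₁) (hρ₁V : ρ₁ ≤ δV) (hρ₁G : ρ₁ + σ ≤ δ) (hρ₂ : 0 ≤ ρ₂) (hρ₂₁ : ρ₂ + σ ≤ ρ₁) (hρ₃ : 0 ≤ ρ₃) (hρ₃N : ρ₃ ≤ ρN) (hρ₃V : ρ₃ ≤ δN - ε)
    (hρ₃₂ : ρ₃ + σ ≤ ρ₂) (hε : 0 < ε) (hc₀ : 0 ≤ c₀) (hc₁ : 0 ≤ c₁) (hc₂ : 0 ≤ c₂) (ho₀ : 0 ≤ o₀) (ho₁ : 0 ≤ o₁) (ho₂ : 0 ≤ o₂) (hoo : 0 ≤ oo) (hrW : 0 ≤ rW) (hrA : 0 ≤ rA)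
    (hoAt : 0 ≤ oAt) (hcN : 0 ≤ cN) (hrN : 0 ≤ rN) (hcV : 0 ≤ cV) (hrV : 0 ≤ rV) (hℓ : 0 ≤ ℓ) (hω : 0 ≤ ω)
    (hDqf : ∀ μ, Dq (Sum.inl μ) = fgrad n (liftEquiv (τ μ) ι)) (hDqb : ∀ μ, Dq (Sum.inr μ) = bgrad n (liftEquiv (τ μ) ι)) (hDq : ∀ j, D j = Dq j ∘ₗ G₀)
    (hDqf' : ∀ μ, Dq' (Sum.inl μ) = fgrad n' (liftEquiv (τ' μ) ι)) (hDqb' : ∀ μ, Dq' (Sum.inr μ) = bgrad n' (liftEquiv (τ' μ) ι)) (hDq' : ∀ j, D' j = Dq' j ∘ₗ G₀')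
    {S : Set g.Site} {χX ψX ψ₂X : X → ℝ} {χX' ψX' ψ₂X' : X' → ℝ}
    (hSχ : ∀ x, χX x ≠ 0 → blk x ∈ S) (hSψ : ∀ x, ψX x ≠ 0 → blk x ∈ S) (hSψ₂ : ∀ x, ψ₂X x ≠ 0 → blk x ∈ S)
    (hSχ' : ∀ x', χX' x' ≠ 0 → blk (π x') ∈ S) (hSψ' : ∀ x', ψX' x' ≠ 0 → blk (π x') ∈ S) (hSψ₂' : ∀ x', ψ₂X' x' ≠ 0 → blk (π x') ∈ S)
    (hmf : ∀ μ x, ψX x ≠ 0 → ψ₂X x = 1 ∧ ψ₂X (τ μ x) = 1) (hmb : ∀ μ x, ψX x ≠ 0 → ψ₂X x = 1 ∧ ψ₂X ((τ μ).symm x) = 1)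
    (hmf' : ∀ μ x', ψX' x' ≠ 0 → ψ₂X' x' = 1 ∧ ψ₂X' (τ' μ x') = 1) (hmb' : ∀ μ x', ψX' x' ≠ 0 → ψ₂X' x' = 1 ∧ ψ₂X' ((τ' μ).symm x') = 1)
    (hGχ : mulOp (fun p : X × ι => χX p.1) ∘ₗ G₀ = G₀) (hGψ : G₀ ∘ₗ mulOp (fun p : X × ι => ψX p.1) = G₀)
    (hGχ' : mulOp (fun p : X' × ι => χX' p.1) ∘ₗ G₀' = G₀') (hGψ' : G₀' ∘ₗ mulOp (fun p : X' × ι => ψX' p.1) = G₀')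
    {W N : (X × ι → ℝ) →ₗ[ℝ] (X × ι → ℝ)} {W' N' : (X' × ι → ℝ) →ₗ[ℝ] (X' × ι → ℝ)} {hb : g.Site → ℝ}
    -- the partition: vector-carrier letters `c₁, c₂` and the five translated fits (the flat half)
    (hh1v : ∀ μ p, |fgrad n (liftEquiv (τ μ) ι) (fun p : X × ι => hX p.1) p| ≤ c₁) (hh1bv : ∀ μ p, |bgrad n (liftEquiv (τ μ) ι) (fun p : X × ι => hX p.1) p| ≤ c₁)
    (hh2 : ∀ μ p, |fgradAdj n (liftEquiv (τ μ) ι) (fgrad n (liftEquiv (τ μ) ι) (fun p : X × ι => hX p.1)) p| ≤ c₂)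
    (hh2f : ∀ μ p, |fgrad n (liftEquiv (τ μ) ι) (fgrad n (liftEquiv (τ μ) ι) (fun p : X × ι => hX p.1)) p| ≤ c₂)
    (hh2b : ∀ μ p, |bgrad n (liftEquiv (τ μ) ι) (bgrad n (liftEquiv (τ μ) ι) (fun p : X × ι => hX p.1) ∘ ⇑(liftEquiv (τ μ) ι)) p| ≤ c₂)
    (hF0 : ∀ μ p', |fgradAdj n' (liftEquiv (τ' μ) ι) (fgrad n' (liftEquiv (τ' μ) ι) (fun p' : X' × ι => hX' p'.1)) p' -
      fgradAdj n (liftEquiv (τ μ) ι) (fgrad n (liftEquiv (τ μ) ι) (fun p : X × ι => hX p.1)) (liftMap π ι p')| ≤ o₂)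
    (hF1 : ∀ μ p', |fgrad n' (liftEquiv (τ' μ) ι) (fun p' : X' × ι => hX' p'.1) ((liftEquiv (τ' μ) ι).symm p') -
      fgrad n (liftEquiv (τ μ) ι) (fun p : X × ι => hX p.1) ((liftEquiv (τ μ) ι).symm (liftMap π ι p'))| ≤ o₁)
    (hF2 : ∀ μ p', |fgrad n' (liftEquiv (τ' μ) ι) (fgrad n' (liftEquiv (τ' μ) ι) (fun p' : X' × ι => hX' p'.1)) ((liftEquiv (τ' μ) ι).symm p') -
      fgrad n (liftEquiv (τ μ) ι) (fgrad n (liftEquiv (τ μ) ι) (fun p : X × ι => hX p.1)) ((liftEquiv (τ μ) ι).symm (liftMap π ι p'))| ≤ o₂)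
    (hF3 : ∀ μ p', |bgrad n' (liftEquiv (τ' μ) ι) (fun p' : X' × ι => hX' p'.1) (liftEquiv (τ' μ) ι p') -
      bgrad n (liftEquiv (τ μ) ι) (fun p : X × ι => hX p.1) (liftEquiv (τ μ) ι (liftMap π ι p'))| ≤ o₁)
    (hF4 : ∀ μ p', |bgrad n' (liftEquiv (τ' μ) ι) (bgrad n' (liftEquiv (τ' μ) ι) (fun p' : X' × ι => hX' p'.1) ∘ ⇑(liftEquiv (τ' μ) ι)) p' -
      bgrad n (liftEquiv (τ μ) ι) (bgrad n (liftEquiv (τ μ) ι) (fun p : X × ι => hX p.1) ∘ ⇑(liftEquiv (τ μ) ι)) (liftMap π ι p')| ≤ o₂)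
    -- the partition: scalar letters at both grids, plain fits, block-constant comparison (the dressed perturbation's half)
    (hh1 : ∀ μ x, |fgrad n (τ μ) hX x| ≤ c₁) (hh1b : ∀ μ x, |bgrad n (τ μ) hX x| ≤ c₁) (hh0 : ∀ μ x, |hX (τ μ x) - hX x| ≤ c₀)
    (hh1' : ∀ μ x', |fgrad n' (τ' μ) hX' x'| ≤ c₁) (hh1b' : ∀ μ x', |bgrad n' (τ' μ) hX' x'| ≤ c₁) (hh0' : ∀ μ x', |hX' (τ' μ x') - hX' x'| ≤ c₀)
    (hf1 : ∀ μ x', |fgrad n' (τ' μ) hX' x' - fgrad n (τ μ) hX (π x')| ≤ o₁) (hf1b : ∀ μ x', |bgrad n' (τ' μ) hX' x' - bgrad n (τ μ) hX (π x')| ≤ o₁)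
    (hf0 : ∀ μ x', |(hX' (τ' μ x') - hX' x') - (hX (τ μ (π x')) - hX (π x'))| ≤ o₀)
    (hf0b : ∀ μ x', |(hX' x' - hX' ((τ' μ).symm x')) - (hX (π x') - hX ((τ μ).symm (π x')))| ≤ o₀)
    (hfit : ∀ x', |hX' x' - hX (π x')| ≤ oo) (hLip : ∀ y y', |hb y - hb y'| ≤ ℓ * g.dist y y') (hrh : ∀ x, |hX x - hb (blk x)| ≤ ω) (hrh' : ∀ x', |hX' x' - hb (blk (π x'))| ≤ ω)
    -- the species rows and translated fits
    (hA : ∀ j x i, ∑ k, |A j x i k| ≤ rA)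
    (hfAb : ∀ μ x' i, ∑ k, |A' (Sum.inl μ) ((τ' μ).symm x') i k - A (Sum.inl μ) ((τ μ).symm (π x')) i k| ≤ oAt)
    (hfAf : ∀ μ x' i, ∑ k, |A' (Sum.inr μ) (τ' μ x') i k - A (Sum.inr μ) (τ μ (π x')) i k| ≤ oAt)
    -- both grids' flat cubes, right entries, defects
    (hG : HasMaj (BlockNorm.ofBlocks g (liftBlk blk ι)) (BlockNorm.ofBlocks g (liftBlk blk ι)) G₀ (fun y y' => β * Real.exp (-(δ * g.dist y y'))))
    (hD : ∀ j, HasMaj (BlockNorm.ofBlocks g (liftBlk blk ι)) (BlockNorm.ofBlocks g (liftBlk blk ι)) (D j) (fun y y' => β * Real.exp (-(δ * g.dist y y'))))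
    (hG' : HasMaj (BlockNorm.ofBlocks g (liftBlk (blk ∘ π) ι)) (BlockNorm.ofBlocks g (liftBlk (blk ∘ π) ι)) G₀' (fun y y' => β * Real.exp (-(δ * g.dist y y'))))
    (hD' : ∀ j, HasMaj (BlockNorm.ofBlocks g (liftBlk (blk ∘ π) ι)) (BlockNorm.ofBlocks g (liftBlk (blk ∘ π) ι)) (D' j) (fun y y' => β * Real.exp (-(δ * g.dist y y'))))
    (hDG : HasMaj (BlockNorm.ofBlocks g (liftBlk blk ι)) (BlockNorm.ofBlocks g (liftBlk (blk ∘ π) ι)) (idef (pull (liftMap π ι)) (pull (liftMap π ι)) G₀' G₀)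
      (fun y y' => mG * Real.exp (-(δ * g.dist y y'))))
    (hDD : ∀ j, HasMaj (BlockNorm.ofBlocks g (liftBlk blk ι)) (BlockNorm.ofBlocks g (liftBlk (blk ∘ π) ι)) (idef (pull (liftMap π ι)) (pull (liftMap π ι)) (D' j) (D j))
      (fun y y' => mG * Real.exp (-(δ * g.dist y y'))))
    (hGQf : ∀ μ, HasMaj (BlockNorm.ofBlocks g (liftBlk blk ι)) (BlockNorm.ofBlocks g (liftBlk blk ι)) (G₀ ∘ₗ fgrad n (liftEquiv (τ μ) ι)) (fun y y' => β₂ * Real.exp (-(δ * g.dist y y'))))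
    (hDQf : ∀ μ j, HasMaj (BlockNorm.ofBlocks g (liftBlk blk ι)) (BlockNorm.ofBlocks g (liftBlk blk ι)) (D j ∘ₗ fgrad n (liftEquiv (τ μ) ι)) (fun y y' => β₂ * Real.exp (-(δ * g.dist y y'))))
    (hGQb : ∀ μ, HasMaj (BlockNorm.ofBlocks g (liftBlk blk ι)) (BlockNorm.ofBlocks g (liftBlk blk ι)) (G₀ ∘ₗ bgrad n (liftEquiv (τ μ) ι)) (fun y y' => β₂ * Real.exp (-(δ * g.dist y y'))))
    (hDQb : ∀ μ j, HasMaj (BlockNorm.ofBlocks g (liftBlk blk ι)) (BlockNorm.ofBlocks g (liftBlk blk ι)) (D j ∘ₗ bgrad n (liftEquiv (τ μ) ι)) (fun y y' => β₂ * Real.exp (-(δ * g.dist y y'))))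
    (hGQf' : ∀ μ, HasMaj (BlockNorm.ofBlocks g (liftBlk (blk ∘ π) ι)) (BlockNorm.ofBlocks g (liftBlk (blk ∘ π) ι)) (G₀' ∘ₗ fgrad n' (liftEquiv (τ' μ) ι))
      (fun y y' => β₂ * Real.exp (-(δ * g.dist y y'))))
    (hDQf' : ∀ μ j, HasMaj (BlockNorm.ofBlocks g (liftBlk (blk ∘ π) ι)) (BlockNorm.ofBlocks g (liftBlk (blk ∘ π) ι)) (D' j ∘ₗ fgrad n' (liftEquiv (τ' μ) ι))
      (fun y y' => β₂ * Real.exp (-(δ * g.dist y y'))))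
    (hGQb' : ∀ μ, HasMaj (BlockNorm.ofBlocks g (liftBlk (blk ∘ π) ι)) (BlockNorm.ofBlocks g (liftBlk (blk ∘ π) ι)) (G₀' ∘ₗ bgrad n' (liftEquiv (τ' μ) ι))
      (fun y y' => β₂ * Real.exp (-(δ * g.dist y y'))))
    (hDQb' : ∀ μ j, HasMaj (BlockNorm.ofBlocks g (liftBlk (blk ∘ π) ι)) (BlockNorm.ofBlocks g (liftBlk (blk ∘ π) ι)) (D' j ∘ₗ bgrad n' (liftEquiv (τ' μ) ι))
      (fun y y' => β₂ * Real.exp (-(δ * g.dist y y'))))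
    (hDGQf : ∀ μ, HasMaj (BlockNorm.ofBlocks g (liftBlk blk ι)) (BlockNorm.ofBlocks g (liftBlk (blk ∘ π) ι))
      (idef (pull (liftMap π ι)) (pull (liftMap π ι)) (G₀' ∘ₗ fgrad n' (liftEquiv (τ' μ) ι)) (G₀ ∘ₗ fgrad n (liftEquiv (τ μ) ι))) (fun y y' => mQ * Real.exp (-(δ * g.dist y y'))))
    (hDDQf : ∀ μ j, HasMaj (BlockNorm.ofBlocks g (liftBlk blk ι)) (BlockNorm.ofBlocks g (liftBlk (blk ∘ π) ι))
      (idef (pull (liftMap π ι)) (pull (liftMap π ι)) (D' j ∘ₗ fgrad n' (liftEquiv (τ' μ) ι)) (D j ∘ₗ fgrad n (liftEquiv (τ μ) ι))) (fun y y' => mQ * Real.exp (-(δ * g.dist y y'))))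
    (hDGQb : ∀ μ, HasMaj (BlockNorm.ofBlocks g (liftBlk blk ι)) (BlockNorm.ofBlocks g (liftBlk (blk ∘ π) ι))
      (idef (pull (liftMap π ι)) (pull (liftMap π ι)) (G₀' ∘ₗ bgrad n' (liftEquiv (τ' μ) ι)) (G₀ ∘ₗ bgrad n (liftEquiv (τ μ) ι))) (fun y y' => mQ * Real.exp (-(δ * g.dist y y'))))
    (hDDQb : ∀ μ j, HasMaj (BlockNorm.ofBlocks g (liftBlk blk ι)) (BlockNorm.ofBlocks g (liftBlk (blk ∘ π) ι))
      (idef (pull (liftMap π ι)) (pull (liftMap π ι)) (D' j ∘ₗ bgrad n' (liftEquiv (τ' μ) ι)) (D j ∘ₗ bgrad n (liftEquiv (τ μ) ι))) (fun y y' => mQ * Real.exp (-(δ * g.dist y y'))))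
    -- the perturbations' letters and fit, smallness
    (hV : HasMaj (BlockNorm.ofBlocks g (blkPair (liftBlk blk ι))) (BlockNorm.ofBlocks g (liftBlk blk ι)) (unstackM C A + NV ∘ₗ projO (none : Option (J ⊕ J)))
      (fun y y' => R * Real.exp (-(δV * g.dist y y'))))
    (hV' : HasMaj (BlockNorm.ofBlocks g (blkPair (liftBlk (blk ∘ π) ι))) (BlockNorm.ofBlocks g (liftBlk (blk ∘ π) ι)) (unstackM C' A' + NV' ∘ₗ projO (none : Option (J ⊕ J)))
      (fun y y' => R * Real.exp (-(δV * g.dist y y'))))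
    (hDV : HasMaj (BlockNorm.ofBlocks g (blkPair (liftBlk blk ι))) (BlockNorm.ofBlocks g (liftBlk (blk ∘ π) ι))
      (idef (pull (liftPair (liftMap π ι))) (pull (liftMap π ι)) (unstackM C' A' + NV' ∘ₗ projO (none : Option (J ⊕ J))) (unstackM C A + NV ∘ₗ projO (none : Option (J ⊕ J))))
      (fun y y' => o * Real.exp (-(δV * g.dist y y'))))
    (hq : β * (R * cr) * cr < 1)
    -- the `W`-row's defect at the dressed pair, the flat nonlocal summand's commutator letter and defect, the base perturbation's letters and defect
    (hDW : HasMaj (BlockNorm.ofBlocks g (liftBlk blk ι)) (BlockNorm.ofBlocks g (liftBlk (blk ∘ π) ι))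
      (idef (pull (liftMap π ι)) (pull (liftMap π ι)) ((projO none ∘ₗ bgPropV (stack G₀' D') (unstackM C' A' + NV' ∘ₗ projO (none : Option (J ⊕ J)))) ∘ₗ commOp W' (fun p' : X' × ι => hX' p'.1))
        ((projO none ∘ₗ bgPropV (stack G₀ D) (unstackM C A + NV ∘ₗ projO (none : Option (J ⊕ J)))) ∘ₗ commOp W (fun p : X × ι => hX p.1)))
      (fun y y' => ind S y * ind S y' * (rW * Real.exp (-(ρ₂ * g.dist y y')))))
    (hKN : HasMaj (BlockNorm.ofBlocks g (liftBlk blk ι)) (BlockNorm.ofBlocks g (liftBlk blk ι)) (commOp N (fun p : X × ι => hX p.1)) (fun y y' => cN * Real.exp (-(ρN * g.dist y y'))))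
    (hDKN : HasMaj (BlockNorm.ofBlocks g (liftBlk blk ι)) (BlockNorm.ofBlocks g (liftBlk (blk ∘ π) ι))
      (idef (pull (liftMap π ι)) (pull (liftMap π ι)) (commOp N' (fun p' : X' × ι => hX' p'.1)) (commOp N (fun p : X × ι => hX p.1))) (fun y y' => rN * Real.exp (-(ρN * g.dist y y'))))
    (hNV : HasMaj (BlockNorm.ofBlocks g (liftBlk blk ι)) (BlockNorm.ofBlocks g (liftBlk blk ι)) NV (fun y y' => cV * Real.exp (-(δN * g.dist y y'))))
    (hNV' : HasMaj (BlockNorm.ofBlocks g (liftBlk (blk ∘ π) ι)) (BlockNorm.ofBlocks g (liftBlk (blk ∘ π) ι)) NV' (fun y y' => cV * Real.exp (-(δN * g.dist y y'))))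
    (hDNV : HasMaj (BlockNorm.ofBlocks g (liftBlk blk ι)) (BlockNorm.ofBlocks g (liftBlk (blk ∘ π) ι)) (idef (pull (liftMap π ι)) (pull (liftMap π ι)) NV' NV)
      (fun y y' => rV * Real.exp (-(δN * g.dist y y')))) :
    HasMaj (BlockNorm.ofBlocks g (liftBlk blk ι)) (BlockNorm.ofBlocks g (liftBlk (blk ∘ π) ι))
      (idef (pull (liftMap π ι)) (pull (liftMap π ι))
        ((projO none ∘ₗ bgPropV (stack G₀' D') (unstackM C' A' + NV' ∘ₗ projO (none : Option (J ⊕ J)))) ∘ₗ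
          commOp (lapOp n' (fun μ => liftEquiv (τ' μ) ι) W' + N' - (unstackM C' A' + NV' ∘ₗ projO (none : Option (J ⊕ J))) ∘ₗ stack LinearMap.id Dq') (fun p' : X' × ι => hX' p'.1))
        ((projO none ∘ₗ bgPropV (stack G₀ D) (unstackM C A + NV ∘ₗ projO (none : Option (J ⊕ J)))) ∘ₗ
          commOp (lapOp n (fun μ => liftEquiv (τ μ) ι) W + N - (unstackM C A + NV ∘ₗ projO (none : Option (J ⊕ J))) ∘ₗ stack LinearMap.id Dq) (fun p : X × ι => hX p.1)))
      (fun y y' => ind S y * (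
        (((Fintype.card J * (3 * (β * (1 - β * (R * cr) * cr)⁻¹ * o₂ + (mG * cr + 1 * (mG * cr) * (R * (β * (1 - β * (R * cr) * cr)⁻¹) * cr) + β * o * cr * (β * (1 - β * (R * cr) * cr)⁻¹) * cr) * (1 - 1 * (β * (R * cr) * cr))⁻¹ * c₂) + 2 * (β₂ * (1 - β * (R * cr) * cr)⁻¹ * o₁ + (mQ * cr + mG * cr * (R * (β₂ * (1 - β * (R * cr) * cr)⁻¹) * cr) + β * o * cr * (β₂ * (1 - β * (R * cr) * cr)⁻¹) * cr) * (1 - β * (R * cr) * cr)⁻¹ * c₁)) + rW) + (β * (1 - β * (R * cr) * cr)⁻¹) * rN * cr + ((mG * cr + 1 * (mG * cr) * (R * (β * (1 - β * (R * cr) * cr)⁻¹) * cr) + β * o * cr * (β * (1 - β * (R * cr) * cr)⁻¹) * cr) * (1 - 1 * (β * (R * cr) * cr))⁻¹) * cN * cr)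
        + ((Fintype.card J * (2 * (rA * (c₁ * ((mG * cr + 1 * (mG * cr) * (R * (β * (1 - β * (R * cr) * cr)⁻¹) * cr) + β * o * cr * (β * (1 - β * (R * cr) * cr)⁻¹) * cr) * (1 - 1 * (β * (R * cr) * cr))⁻¹) + o₁ * (β * (1 - β * (R * cr) * cr)⁻¹) + c₀ * ((mQ * cr + mG * cr * (R * (β₂ * (1 - β * (R * cr) * cr)⁻¹) * cr) + β * o * cr * (β₂ * (1 - β * (R * cr) * cr)⁻¹) * cr) * (1 - β * (R * cr) * cr)⁻¹) + o₀ * (β₂ * (1 - β * (R * cr) * cr)⁻¹)) + oAt * (c₁ * (β * (1 - β * (R * cr) * cr)⁻¹) + c₀ * (β₂ * (1 - β * (R * cr) * cr)⁻¹)))))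
          + (β * (1 - β * (R * cr) * cr)⁻¹) * (((ℓ * (Real.exp 1 * ε)⁻¹ + 2 * ω) * rV + 2 * oo * cV)) * cr + ((mG * cr + 1 * (mG * cr) * (R * (β * (1 - β * (R * cr) * cr)⁻¹) * cr) + β * o * cr * (β * (1 - β * (R * cr) * cr)⁻¹) * cr) * (1 - 1 * (β * (R * cr) * cr))⁻¹) * ((ℓ * (Real.exp 1 * ε)⁻¹ + 2 * ω) * cV) * cr))
        * Real.exp (-(ρ₃ * g.dist y y')))) := by
  have hq' : 0 < 1 - β * (R * cr) * cr := by linarith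
  have hB : 0 ≤ β * (1 - β * (R * cr) * cr)⁻¹ := mul_nonneg hβ (inv_nonneg.2 hq'.le)
  have hB₂ : 0 ≤ β₂ * (1 - β * (R * cr) * cr)⁻¹ := mul_nonneg hβ₂ (inv_nonneg.2 hq'.le)
  have hM₀ : 0 ≤ (mG * cr + 1 * (mG * cr) * (R * (β * (1 - β * (R * cr) * cr)⁻¹) * cr) + β * o * cr * (β * (1 - β * (R * cr) * cr)⁻¹) * cr) * (1 - 1 * (β * (R * cr) * cr))⁻¹ := by
    have h2 : 0 ≤ (1 - 1 * (β * (R * cr) * cr))⁻¹ := inv_nonneg.2 (by linarith)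
    positivity
  have hM₁ : 0 ≤ (mQ * cr + mG * cr * (R * (β₂ * (1 - β * (R * cr) * cr)⁻¹) * cr) + β * o * cr * (β₂ * (1 - β * (R * cr) * cr)⁻¹) * cr) * (1 - β * (R * cr) * cr)⁻¹ := by
    have h2 : 0 ≤ (1 - β * (R * cr) * cr)⁻¹ := inv_nonneg.2 hq'.le
    positivity
  -- the flat half's defect, two-sided (`…RemainderRowAdjointDefect` §2)
  have hflat := hasMaj_idef_comp_commOp_lapOp_dressedV_loc₂ blk π τ τ' n n' htri hd hrow hσ hcr hβ hβ₂ hR ho hmG hmQ hσρ hρ₁V hρ₁G hρ₂ hρ₂₁ hc₁ hc₂ ho₁ ho₂ hDq hDq' hSχ hSψ hSψ₂ hSχ'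
    hSψ' hSψ₂' hmf hmb hmf' hmb' hGχ hGψ hGχ' hGψ' hh1v hh1bv hh2 hh2f hh2b hF0 hF1 hF2 hF3 hF4 hG hD hG' hD' hDG hDD hGQf hDQf hGQb hDQb hGQf' hDQf' hGQb' hDQb' hDGQf hDDQf hDGQb
    hDDQb hV hV' hDV hq hDW
  -- fine two-sided entry 0 ∕ right entries and the two-sided defects, for both halves
  have hE' := hasMaj_dressedV_loc₂ (blk ∘ π) htri hd hrow hσ hβ hR hcr hσρ hρ₁V hρ₁G hρ₂ hρ₂₁ hSχ' hSψ' hGχ' hGψ' hDq' hG' hD' hV' hq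
  have hED' := fun μ => hasMaj_dressedV_comp_fgrad_loc₂ (blk ∘ π) τ' n' htri hd hrow hσ hβ hβ₂ hR hcr hσρ hρ₁V hρ₁G hρ₂ hρ₂₁ hDq' μ hSχ' hSψ₂' (hmf' μ) hGχ' hGψ' hG' hD' (hGQf' μ)
    (hDQf' μ) hV' hq
  have hEDb' := fun μ => hasMaj_dressedV_comp_bgrad_loc₂ (blk ∘ π) τ' n' htri hd hrow hσ hβ hβ₂ hR hcr hσρ hρ₁V hρ₁G hρ₂ hρ₂₁ hDq' μ hSχ' hSψ₂' (hmb' μ) hGχ' hGψ' hG' hD' (hGQb' μ)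
    (hDQb' μ) hV' hq
  have hDX := hasMaj_idef_dressedV_loc₂ blk π htri hd hrow hσ hcr hβ hR ho hmG hσρ hρ₁V hρ₁G hρ₂ hρ₂₁ hDq hDq' hSχ hSψ hSχ' hSψ' hGχ hGψ hGχ' hGψ' hG hD hG' hD' hDG hDD hV hV' hDV hq
  have hDXD := fun μ => hasMaj_idef_dressedV_comp_fgrad_loc₂ blk π τ τ' n n' htri hd hrow hσ hcr hβ hβ₂ hR ho hmG hmQ hσρ hρ₁V hρ₁G hρ₂ hρ₂₁ hDq hDq' μ hSχ hSψ₂ hSχ' hSψ₂' (hmf μ)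
    (hmf' μ) hGχ hGψ hGχ' hGψ' hG hD hG' hD' hDG hDD (hGQf μ) (hDQf μ) (hDGQf μ) (hDDQf μ) hV hV' hDV hq
  have hDXDb := fun μ => hasMaj_idef_dressedV_comp_bgrad_loc₂ blk π τ τ' n n' htri hd hrow hσ hcr hβ hβ₂ hR ho hmG hmQ hσρ hρ₁V hρ₁G hρ₂ hρ₂₁ hDq hDq' μ hSχ hSψ₂ hSχ' hSψ₂' (hmb μ)
    (hmb' μ) hGχ hGψ hGχ' hGψ' hG hD hG' hD' hDG hDD (hGQb μ) (hDQb μ) (hDGQb μ) (hDDQb μ) hV hV' hDV hq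
  -- the flat + nonlocal half, output-localized (`…CommutatorAdjoint` §1)
  have hrflat : 0 ≤ Fintype.card J *
      (3 * (β * (1 - β * (R * cr) * cr)⁻¹ * o₂ +
          (mG * cr + 1 * (mG * cr) * (R * (β * (1 - β * (R * cr) * cr)⁻¹) * cr) + β * o * cr * (β * (1 - β * (R * cr) * cr)⁻¹) * cr) * (1 - 1 * (β * (R * cr) * cr))⁻¹ * c₂) +
        2 * (β₂ * (1 - β * (R * cr) * cr)⁻¹ * o₁ +
          (mQ * cr + mG * cr * (R * (β₂ * (1 - β * (R * cr) * cr)⁻¹) * cr) + β * o * cr * (β₂ * (1 - β * (R * cr) * cr)⁻¹) * cr) * (1 - β * (R * cr) * cr)⁻¹ * c₁)) + rW := by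
    positivity
  have h1 := hasMaj_idef_comp_commOp_of_add (liftBlk blk ι) (liftMap π ι) htri hd hrow hσ hrflat hB hM₀ hcN hrN hρ₃ hρ₃N hρ₃₂ hflat hE' hDX hKN hDKN
  -- the dressed perturbation's half, output-localized (`…CommutatorAdjoint` §2)
  have h2 := hasMaj_idef_comp_commOp_speciesOpM_add blk π τ τ' n n' C C' A A' hX hX' (projO none ∘ₗ bgPropV (stack G₀ D) (unstackM C A + NV ∘ₗ projO (none : Option (J ⊕ J))))
    (projO none ∘ₗ bgPropV (stack G₀' D') (unstackM C' A' + NV' ∘ₗ projO (none : Option (J ⊕ J)))) htri hd hsymm hrow hσ hB hB₂ hc₁ hc₀ ho₁ ho₀ hM₀ hM₁ hrA hoAt hcV hrV hoo hℓ hω hε hρ₃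
    hρ₃V hρ₃₂ hh1 hh1b hh0 hh1' hh1b' hh0' hf1 hf1b hf0 hf0b hfit hLip hrh hrh' hA hfAb hfAf hE' hED' hEDb' hDX hDXD hDXDb hNV hNV' hDNV
  -- algebra: `[Δ_flat + N − 𝒱, M_h] = [Δ_flat + N, M_h] − [V(C,A) + N_V, M_h]` at both grids
  have hDqE : Dq = fun j : J ⊕ J => Sum.elim (fun μ => fgrad n (liftEquiv (τ μ) ι)) (fun μ => bgrad n (liftEquiv (τ μ) ι)) j := by
    funext j
    rcases j with μ | μ
    · exact hDqf μ
    · exact hDqb μ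
  have hDqE' : Dq' = fun j : J ⊕ J => Sum.elim (fun μ => fgrad n' (liftEquiv (τ' μ) ι)) (fun μ => bgrad n' (liftEquiv (τ' μ) ι)) j := by
    funext j
    rcases j with μ | μ
    · exact hDqf' μ
    · exact hDqb' μ
  subst hDqE hDqE'
  rw [unstackM_add_base_comp_jet, unstackM_add_base_comp_jet, commOp_sub_left, commOp_sub_left, LinearMap.comp_sub, LinearMap.comp_sub, idef_sub]
  refine (h1.sub h2).mono fun y y' => le_of_eq ?_
  ring

end Assembly

end Summit.QuantumFields.YangMills.BalabanUVNodes.N15.CurvedSpecies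

end
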